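import Summits.QuantumFields.Balaban3D.Proofs.UVStability3DInputs
import Summits.QuantumFields.Balaban3D.Proofs.InputsAC
import Summits.QuantumFields.Balaban3D.Proofs.Bound55AC

/-!
# Bałaban CMP 102 (1985), d = 3 lane — `Proofs.AlphaAC`: **THE (α) INPUT PACKAGE OVER AN ABSOLUTELY CONTINUOUS AVERAGING** — seat p3's
# `UVStability3DInputs` §1 (`AlphaData`, `StepAlpha`, `RunAlpha`: the lane's 31 countersigned input rows) re-typed over
# `StandardAC.ExternalInputsAC` (the averaging `Ū` with `Carriers.AvgAC` only, NO exact Haar compatibility) and the AC tower with UNCAPPED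
# masses (`InputsAC.inputOfAC`/`towerOfAC`/`piecesAC`, residuals `Bound55AC.Fibre49AC`/`Fibre57LowAC`) — lane `pub-balaban3d`, seat alpha-1
# (definition request `defn-AlphaInputsT3AC` of route `UnitScaleTilt`, cell ym3-torus)

WHAT CHANGES AGAINST `UVStability3DInputs` (finding F-α1-1; UST owner ruling 2026-08-26, pub/ym3-torus STATUS: the package pinned to the T³
family's block averaging `blockAvg ℰp` cannot carry `ExternalInputs.av_map`): the external inputs are `X : ExternalInputsAC S G`; every row is
the SAME printed display read at the AC objects — the two (β) RESIDUALS R3D-01/R3D-02 become `Fibre49AC`/`Fibre57LowAC` (transported form over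
the exact-transport masses, so the local Jacobians of `Ū` ride inside both sides); the GAP binders G3D-07/G3D-08 are instantiated at
`towerOfAC`/`piecesAC`; `hU`/`hPm`/`hPb` at `inputOfAC`; all other rows are about the expansion data `𝔖`, the auxiliary data and the primitive
constants `𝔠 : Primitives.AlphaConsts` and are VERBATIM.  Row texts, locators and classes: see `UVStability3DInputs` (module docstring) and
the lane's INPUTS.md.  HYPOTHESES; nothing asserted.  The consequences (Theorem 2 = (41) ∧ (47) for the AC tower, `…Proofs.Thm2AC`) and the
T³ pinning (`Summits/QuantumFields/YangMills/Theorems/AlphaInputsT3AC`) are downstream.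
-/

noncomputable section

namespace Summit.QuantumFields.Balaban3D.Proofs.AlphaAC

open MeasureTheory Metric
open scoped BigOperators Matrix.Norms.L2Operator
open Literature.MathematicalPhysics.QuantumFieldTheory.Balaban1983to89
open Literature.MathematicalPhysics.QuantumFieldTheory.Balaban1983to89.B10
open Literature.MathematicalPhysics.QuantumFieldTheory.Balaban1983to89.B10SectAGathering
open Literature.MathematicalPhysics.QuantumFieldTheory.Balaban1983to89.B10SectCExpansion (Bound44)
open Literature.MathematicalPhysics.QuantumFieldTheory.Balaban1983to89.B10Eq24Cumulant (chiMeasure)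
open Literature.MathematicalPhysics.QuantumFieldTheory.Balaban1983to89.TreeLengthTorus (tsys)
open Literature.MathematicalPhysics.QuantumFieldTheory.Balaban1985CMP102
open Literature.MathematicalPhysics.QuantumFieldTheory.Balaban1985CMP102.Setting
open Literature.MathematicalPhysics.QuantumFieldTheory.Balaban1985CMP102.Binders
  (ChartAnalyticityAsCited FarTermsDecayAsCited Norm35StepAsCited LogZTExtensiveAsCited LogZLocalizedAsCited GraphRep23AsCited)
open Literature.MathematicalPhysics.QuantumFieldTheory.Balaban1985CMP102.BindersNewborn (NewbornTerms45AsCited)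
open Summit.QuantumFields.Balaban3D.Carriers
open Summit.QuantumFields.Balaban3D.Proofs.Inputs
open Summit.QuantumFields.Balaban3D.Proofs.Primitives
open Summit.QuantumFields.Balaban3D.Proofs.UVStability3DInputs (lieChart adjAct)
open Summit.QuantumFields.Balaban3D.Proofs.Representation33 (jet26)
open Summit.QuantumFields.Balaban3D.Proofs.LiftBridge (liftCfg)
open Summit.QuantumFields.Balaban3D.Proofs.Run3SmallFactors (codeZ)
open Summit.QuantumFields.Balaban3D.Proofs.GroupModelLieC (lieC adC)
open Summit.QuantumFields.Balaban3D.Proofs.StandardAC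
open Summit.QuantumFields.Balaban3D.Proofs.InputsAC
open Summit.QuantumFields.Balaban3D.Proofs.Bound55AC
open B7Prop1Explicit (hol plaqWord)
open B7Prop1Local (pdevOn loK plaqHiK)
open B7Prop2Explicit (avgIter)

variable {L : ℕ}

section Alpha

variable {S : Scales L} {G : Type} [GaugeGroup G] [MeasurableSpace G] [HaarData G] (𝔊 : GroupModel G) (𝔠 : AlphaConsts L 𝔊.N)
  (X : ExternalInputsAC S G) (𝔖 : ∀ k, StepSeries S G ↥(lieC 𝔊) (nblkOf S 𝔠.lane.carrier k) k)

/-- **AUXILIARY EXPANSION DATA** the (α) displays speak about, beyond `Carriers.StepSeries`: per step `k`, the instance of the lane's GAP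
binder G3D-07 «(63) as cited» (`Binders.LogZLocalizedAsCited`: the localized pieces `Ψ` and far monomials of `log Z^{(k)}(B(Λ_{k+1}), ·)`,
for the DEFINED `logZU`/`logZ1` of the pieces, the domains inside `Ω_{k+1}(h)`, the chart configurations `Bcfg`, the adjoint action) and of
G3D-08 «(45) as cited» for its (61)-born pieces (`BindersNewborn.NewbornTerms45AsCited`, constant `C45`), the box bound `Bv` of the
effective potential of (58), the upper bound `cP` of the interaction sum (43), and the constants of G3D-02's graph bound (23) (free per
step).  DATA carrying the two binders' hypotheses BY NAME; nothing else asserted. [cite: Balaban1985UV3, (23) p.262 + (45) p.267 + (58) p.270 + (63) p.272] -/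
structure AlphaDataAC where
  /-- G3D-07 «(63) as cited» at step `k` -/
  Λc : ∀ k, LogZLocalizedAsCited (towerOfAC 𝔠.lane X 𝔖) k (𝔖 k).E (adjAct 𝔊 (P := S.P) k) 𝔠.ρ 𝔠.r₀ 𝔠.Cfar 𝔠.C63 𝔠.κ
    (piecesAC 𝔠.lane X 𝔖 k).logZU (piecesAC 𝔠.lane X 𝔖 k).logZ1 (𝔖 k).Bcfg
    (fun h => Finset.univ.filter fun Y : (tsys 3 (nblkOf S 𝔠.lane.carrier k)).Dom =>
      Y.1 ⊆ ΩblkOf 𝔠.lane.carrier.M₁ (rcolOf S 𝔠.lane.carrier) (nblkOf S 𝔠.lane.carrier k) h)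
  /-- G3D-08 «(45) as cited» for the (61)-born pieces of `Λc k`, at step `k` -/
  N45 : ∀ k, NewbornTerms45AsCited (towerOfAC 𝔠.lane X 𝔖) k (𝔖 k).E (adjAct 𝔊 (P := S.P) k) 𝔠.ρ 𝔠.r₀ 𝔠.Cfar 𝔠.C63 𝔠.κ
    (piecesAC 𝔠.lane X 𝔖 k).logZU (piecesAC 𝔠.lane X 𝔖 k).logZ1 (𝔖 k).Bcfg
    (fun h => Finset.univ.filter fun Y : (tsys 3 (nblkOf S 𝔠.lane.carrier k)).Dom =>
      Y.1 ⊆ ΩblkOf 𝔠.lane.carrier.M₁ (rcolOf S 𝔠.lane.carrier) (nblkOf S 𝔠.lane.carrier k) h) (Λc k) 𝔠.C45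
  /-- bound of the effective potential on the box, per step -/
  Bv : ℕ → ℝ
  /-- upper bound of the interaction sum `Pint k` of (43), per step -/
  cP : ℕ → ℝ
  /-- G3D-02 constants of (23), per step -/
  C₂₃ : ℕ → ℝ
  /-- G3D-02 constants of (23), per step -/
  c₂₃ : ℕ → ℝ
  /-- G3D-02 constants of (23), per step -/
  M₂₃ : ℕ → ℝ
  /-- G3D-02 constants of (23), per step -/
  δ₀ : ℕ → ℝ

variable (𝔄 : AlphaDataAC 𝔊 𝔠 X 𝔖)

open Classical in
/-- **THE (α) INPUTS OF STEP `k → k+1`** at the lane's pieces (LEAF-LEDGER §F; classes in the module docstring).  HYPOTHESES; nothing asserted.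
[cite: Balaban1985UV3, (23)–(33) pp.262–264 + (44) p.267 + (55)–(63) pp.269–272] -/
structure StepAlphaAC (k : ℕ) : Prop where
  /-- the Gaussian measure of (58) is a probability measure -/
  hμ : IsProbabilityMeasure (𝔖 k).μ
  /-- the small-field box is measurable -/
  hboxm : ∀ h, MeasurableSet ((𝔖 k).box h)
  /-- … of positive measure -/
  hbox : ∀ h, (𝔖 k).μ ((𝔖 k).box h) ≠ 0
  /-- the effective potential is a.e.-measurable -/
  hVm : ∀ h U, AEMeasurable ((𝔖 k).𝒱 h U) (𝔖 k).μ
  /-- … and bounded on the box -/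
  hVB : ∀ h U, ∀ ω ∈ (𝔖 k).box h, |(𝔖 k).𝒱 h U ω| ≤ 𝔄.Bv k
  /-- G3D-01 at the (25)-rate (R-ACT) -/
  chart : ∀ Y, ChartAnalyticityAsCited ((𝔖 k).Ψ Y) 𝔠.ρ
    (𝔠.C25 * S.gk k * Real.exp (-(𝔠.κ * (tsys 3 (nblkOf S 𝔠.lane.carrier k)).dj Y)))
  /-- (28) p. 263 -/
  bound28 : ∀ Y h U, ‖(𝔖 k).Bcfg Y h U‖ ≤ 𝔠.cB * (rFun 𝔠.r₀ (S.gk k) * S.gk k * pFun 𝔠.b₀ 𝔠.p₀ (S.gk k))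
  /-- (26) in the chart space, for the adjoint action -/
  inv26 : ∀ Y (U : G), ∀ b ∈ ball (0 : (𝔖 k).E) 𝔠.ρ, adjAct 𝔊 (P := S.P) k U b ∈ ball (0 : (𝔖 k).E) 𝔠.ρ →
    (𝔖 k).Ψ Y (adjAct 𝔊 (P := S.P) k U b) = (𝔖 k).Ψ Y b
  /-- G3D-06 -/
  far_le : FarTermsDecayAsCited (𝔖 k).far
    (fun Y => 𝔠.C25 * S.gk k * Real.exp (-(𝔠.κ * (tsys 3 (nblkOf S 𝔠.lane.carrier k)).dj Y)))
    𝔠.Cfar (S.gk k ^ 7 * (rFun 𝔠.r₀ (S.gk k) * pFun 𝔠.b₀ 𝔠.p₀ (S.gk k)) ^ 7)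
  /-- identification of `PY` with the retained jet (batch 11 (a)) -/
  hPY : ∀ h U, (𝔖 k).PY h U
    = ∑ Y ∈ (𝔖 k).loc (ΩblkOf 𝔠.lane.carrier.M₁ (rcolOf S 𝔠.lane.carrier) (nblkOf S 𝔠.lane.carrier k)) (rretOf S 𝔠.lane.carrier k) h,
        ((jet26 ((𝔖 k).Ψ Y) ((𝔖 k).Bcfg Y h U)).re - (𝔖 k).far Y h U)
  /-- identification of `PYZ` with the retained jet of the G3D-07 pieces -/
  hPYZ : ∀ h U, (𝔖 k).PYZ h U
    = ∑ Y ∈ (𝔖 k).loc (ΩblkOf 𝔠.lane.carrier.M₁ (rcolOf S 𝔠.lane.carrier) (nblkOf S 𝔠.lane.carrier k)) (rretOf S 𝔠.lane.carrier k) h,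
        ((jet26 ((𝔄.Λc k).Ψ Y) ((𝔖 k).Bcfg Y h U)).re - (𝔄.Λc k).far Y h U)
  /-- G3D-04 -/
  norm35 : Norm35StepAsCited (piecesAC 𝔠.lane X 𝔖 k) 𝔠.c35 𝔠.a35 𝔠.cv 𝔠.cJ35
  /-- G3D-05 -/
  logZT : LogZTExtensiveAsCited (piecesAC 𝔠.lane X 𝔖 k) 𝔠.cT 𝔠.aT 𝔠.cn 𝔠.cJT
  /-- R-ACT: the graph carrier's activities are the chart activities -/
  hact : ∀ h Y U, ((𝔖 k).Gt h).activities.act Y U = (𝔖 k).act h Y U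
  /-- G3D-02 -/
  hG : ∀ h, GraphRep23AsCited ((𝔖 k).Gt h) (fun U => ∑ n ∈ Finset.Icc 1 𝔠.nbar, (𝔖 k).cum h U n / (n.factorial : ℝ))
    (𝔄.C₂₃ k) (𝔄.c₂₃ k) (𝔄.M₂₃ k) (𝔄.δ₀ k)
  /-- [B1] (3.24) input (a), in the unit `(L^kg₀²)^{3+κ₀}|T₁^{(k)}|` -/
  h324a : ∀ h (U : GaugeField S.P (k + 1) G), |Real.log ((𝔖 k).μ.real ((𝔖 k).box h))| ≤
    𝔠.Ca * ((L : ℝ) ^ k * S.g0sq) ^ (3 + 𝔠.κ₀) * S.sites k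
  /-- [B1] (3.24) input (c) -/
  h324c : ∀ h U, ∀ t ∈ Set.Icc (0 : ℝ) 1, |iteratedDeriv (𝔠.nbar + 1) (ProbabilityTheory.cgf ((𝔖 k).𝒱 h U)
    (chiMeasure (𝔖 k).μ (((𝔖 k).box h).indicator fun _ => (1 : ℝ)))) t| ≤
      𝔠.Cc * ((𝔠.nbar + 1).factorial : ℝ) * ((L : ℝ) ^ k * S.g0sq) ^ (3 + 𝔠.κ₀) * S.sites k
  /-- (44) p. 267 on the previous-scale terms of the data (ONE row: consumers B15 and C10) -/
  h44 : ∀ (h : Hist S.P (k + 1)) (U : GaugeField S.P (k + 1) G), ∀ j ∈ Finset.Icc 1 k,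
    Bound44 (oldGeom S.P k j) (fun y n c => (𝔖 k).oldVal h U j y n c) 𝔠.κ₁ (𝔠.M₁ : ℝ) (ell S.P k j) (L : ℝ) 𝔠.B₃
      (S.gk k) (pFun 𝔠.b₀ 𝔠.p₀ (S.gk k)) 𝔠.C44
  /-- the degree floor «n ≥ 2» of (43) for the previous-scale terms -/
  hfloor : ∀ (h : Hist S.P (k + 1)) (U : GaugeField S.P (k + 1) G), ∀ j ∈ Finset.Icc 1 k,
    ∀ (y : Site S.P j) (n : ℕ) (c : Fin n → PBond S.P j), (𝔖 k).oldVal h U j y n c ≠ 0 → 2 ≤ n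
  /-- EXTERNAL-input property ([7] Thm 1): the composite minimizer map `U_k(·, h)` is measurable -/
  hU : ∀ h : Hist S.P k, Measurable (X.UkH k h)
  /-- data regularity: the interaction sum `Pint k h` of (43) (DEFINED from the activities) is measurable in `U` … -/
  hPm : ∀ h : Hist S.P k, Measurable ((inputOfAC 𝔠.lane X 𝔖).Pint k h)
  /-- … and bounded above -/
  hPb : ∀ (h : Hist S.P k) (U : GaugeField S.P k G), (inputOfAC 𝔠.lane X 𝔖).Pint k h U ≤ 𝔄.cP k
  /-- RESIDUAL R3D-01 (p4): «The integral (49)» ≤ (55)·(58), per new history -/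
  fibre49 : ∀ h' : Hist S.P (k + 1), Fibre49AC X 𝔠.lane.carrier 𝔖 (fun _ => True) k (piecesWAC 𝔠.lane X 𝔖 k) h'
  /-- RESIDUAL R3D-02 (p4): the lower step bound at the trivial history -/
  fibre57Low : Fibre57LowAC X 𝔠.lane.carrier 𝔖 (fun _ => True) k (piecesWAC 𝔠.lane X 𝔖 k)

/-- **THE (α) INPUTS OF ONE LATTICE APPROXIMATION**: the step inputs for every `k < K`; the displays (67) ∘ large field and (68) about the
lifted composite minimizers `X.UkH` of [7] (B25).  (The provisos NOT IN PRINT of row B25 — `3r₀ + 2 ≤ 2p₀`, `8·A·K_c³/(½ log L) ≤ b₀²/(4N)`,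
`56 ≤ b₀²/(4N)` — are THEOREMS by the definition of `p₀`, `b₀` in `Primitives` (R-E2′, `Family.prov_hp/prov_hb₁/prov_hb₂`).)  HYPOTHESES.
[cite: Balaban1985UV3, (67)–(68) p.273 + pp.273–274] -/
structure RunAlphaAC : Prop where
  /-- the step inputs -/
  steps : ∀ k, k + 1 ≤ S.K → StepAlphaAC 𝔊 𝔠 X 𝔖 𝔄 k
  /-- (67) ∘ the large-field characteristic function of the history, on the averaged lifted minimizers -/
  hLF67 : ∀ k, k ≤ S.K → ∀ (h : Hist S.P k), Hist.Admissible 𝔠.lane.carrier.M₁ (rcolOf S 𝔠.lane.carrier) k h →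
    ∀ (U : GaugeField S.P k G), ∀ e ∈ Hist.disc h, S.gk e.1 * pFun 𝔠.lane.carrier.b₀ 𝔠.lane.carrier.p₀ (S.gk e.1) ≤
      ‖((hol (avgIter L (liftCfg 𝔊 (X.UkH k h U)) e.1) (codeZ e) (plaqWord e.2.2.1 e.2.2.2) :
          (Matrix (Fin 𝔊.N) (Fin 𝔊.N) ℂ)ˣ) : Matrix (Fin 𝔊.N) (Fin 𝔊.N) ℂ) - 1‖
  /-- (68) on the lifted minimizers -/
  h68 : ∀ k, k ≤ S.K → ∀ (h : Hist S.P k), Hist.Admissible 𝔠.lane.carrier.M₁ (rcolOf S 𝔠.lane.carrier) k h →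
    ∀ (U : GaugeField S.P k G), ∀ e ∈ Hist.disc h,
      pdevOn (loK L e.1 (codeZ e)) (plaqHiK L e.1 (codeZ e) e.2.2.1 e.2.2.2) (liftCfg 𝔊 (X.UkH k h U)) <
        𝔠.C68 * (S.gk e.1 * pFun 𝔠.lane.carrier.b₀ 𝔠.lane.carrier.p₀ (S.gk e.1)) * (((L : ℝ) ^ e.1)⁻¹) ^ 2

end Alpha

end Summit.QuantumFields.Balaban3D.Proofs.AlphaAC

end
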